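import Summits.BirchSwinnertonDyer.Rank1Residual.Additive.CyclotomicThreeRankOneOneDescentAlgebra
import HarnessLib

/-!
# Rank `(1,1)` descent data over a quadratic field — the REGULATOR FACTORISATIONS
# `M²·Reg(V_K) = 4·Reg(V)·Reg(W)` (Néron–Tate and `p`-adic) through Galois orthogonality, and Milne's
# Weil-restriction identity in rank `(1,1)` with the regulators eliminated (cell `b2b-bsdres`, team
# n1011, seat p16; OWNERS row T-S9-K = sub-target (S9), file 2 of 2 of its descent data)

HONEST FRAMING (cell `b2b-bsdres`, run/shared/lean/b2b/bsd-rank1-residual/, verbatim in every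
file): the goal of the cell is to DELETE the COMBINATION-SHAPED residual classes of the
Birch–Swinnerton-Dyer formula for ALL analytic-rank `≤ 1` elliptic curves over `ℚ` — "full BSD
formula for every rank `≤ 1` curve in class `C`" assembled STRICTLY from published theorems — so
that the rank-`≤ 1` remainder becomes exactly the CONSTRUCTION-SHAPED classes, which are TYPED
(missing-input `Prop`s), NOT attempted. This is not "finishing BSD". Team n1011 (N10 / N11 / O7),
seat p16: research route; the labels of X3 / X4 and the N10 / N11 / O7 marks are UNCHANGED by this
file; nothing is booked here.

Theorems only (no `def`, no `sorry`, no named fact). The `(r_an V, r_an W) = (1,1)` twin of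
`CyclotomicThreeRankOneTwistDescentData` (ranks `(0,1)`): `V/ℚ` of rank ONE (basis `{P₀}`), its twist
`W = C • V^{(d_K)}` of rank ONE (basis `{P₁}`), `K` quadratic, so `V(K)` has rank `2` (basis
`B = (B₀, B₁)`); `σ` an algebra endomorphism of `K` (the conjugation) and `Φ : W(ℚ) →+ V(K)` a twisting
transport DOUBLING Néron–Tate heights and ANTI-invariant under `σ` (exists:
`exists_conj_twistTransport`). Writing `ιP₀ = aB₀ + bB₁ + t`, `ΦP₁ = cB₀ + dB₁ + t'` (`t, t'` torsion)
and `M := ad − bc` (the index determinant of the sublattice `⟨ιP₀, ΦP₁⟩`; never bounded — it cancels):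

* §1 **`sq_mul_regulator_baseChange_eq_rankOneOne`** — `M²·Reg(V_K) = 4·Reg(V)·Reg(W)`: the Gram
  determinant of `(ιP₀, ΦP₁)` is `⟨ιP₀,ιP₀⟩⟨ΦP₁,ΦP₁⟩ − ⟨ιP₀,ΦP₁⟩² = (2Reg V)(2Reg W) − 0`, the cross term
  vanishing by GALOIS ORTHOGONALITY (`heightPairing_eq_zero_of_conjMap`: `σ` fixes `ιP₀`, negates
  `ΦP₁`); hence `M ≠ 0` (`indexDet_ne_zero_rankOneOne`, regulators are positive);
* §2 **`sq_mul_padicGram_baseChange_eq_rankOneOne`** — the `p`-adic twin for a `K`-height datum `DK`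
  restricting along `ι` to `2·D₀` (`DK.RestrictsTo D₀`, Mazur–Tate–Teitelbaum §II.5) and along `Φ` to
  `2·Dh` (Delbourgo's normalisation of the height of the additive twist, J. Number Theory 95 (2002)
  p. 39) and `σ`-INVARIANT (hypothesis): `M²·(DK(B₀,B₀)DK(B₁,B₁) − DK(B₀,B₁)²) = 4·Reg_p(V,D₀)·Reg_p(W,Dh)`;
* §3 **`card_identity_baseChange_rankOneOne`** — Milne's identity (tree fact
  `Milne1972.bsdQuotient_baseChange_quadratic_anyModel`, hypothesis `hWR`) as an identity of RATIONALS
  with the regulators eliminated by §1 and the periods by `Ω(V)Ω(V^{(d_K)}) = n_V·Ω(V_K/K)`: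
  **`4·C(V⊗K)·#Ш(V_K)·#V(ℚ)_tors²·#W(ℚ)_tors² = M²·n_V·|u_C|·#Ш(V)·#Ш(W)·∏c(V)·∏c(W)·#V(K)_tors²`**, and
  its `p`-adic valuation form `padicVal_card_identity_rankOneOne` (odd `p`; `ord_p M²` kept as a term).

References: [SilvermanAEC2009] VIII.5.4(b), VIII.9.3, Exercise 10.16; [Milne1972ArithmeticAV] §1 Thm. 1
(through [DokchitserDokchitserAnnals2010] §2.1); [MazurTateTeitelbaum1986Invent] §II.4–5;
[Delbourgo2002] p. 39; [BombieriGubler2001] Prop. 1.5.17.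
-/

noncomputable section

open scoped Classical

open WeierstrassCurve WeierstrassCurve.Affine.Point Literature.NumberTheory.EllipticCurves NumberField

namespace Summit.BirchSwinnertonDyer.Rank1Residual.Additive

/-! ## §1 The Néron–Tate regulator factorisation in rank `(1,1)` -/

section Regulators

variable (K : Type) [Field K] [NumberField K] (V : WeierstrassCurve ℚ) [V.IsElliptic]
  (W : WeierstrassCurve ℚ) [W.IsElliptic]

/-- **`M²·Reg(V_K) = 4·Reg(V)·Reg(W)` in rank `(1,1)`.** `K` quadratic, `{P₀}` a Mordell–Weil basis of
`V(ℚ)`, `{P₁}` one of `W(ℚ)`, `B = (B₀,B₁)` one of `V(K)`, `σ` an algebra endomorphism of `K`,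
`Φ : W(ℚ) →+ V(K)` doubling Néron–Tate heights with `σ_*(ΦP) = −ΦP`; `ιP₀ = aB₀ + bB₁ + t`,
`ΦP₁ = cB₀ + dB₁ + t'` (`t, t'` torsion). Then `(ad − bc)²·Reg(V_K) = 4·Reg(V)·Reg(W)`: the Gram
determinant of `(ιP₀, ΦP₁)` equals `(ad−bc)²·Reg(V_K)` (`gram_det_comb_comb`) and equals
`⟨ιP₀,ιP₀⟩_K⟨ΦP₁,ΦP₁⟩_K − ⟨ιP₀,ΦP₁⟩_K² = (2⟨P₀,P₀⟩)(2⟨P₁,P₁⟩) − 0` (heights over `K` restrict with the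
factor `[K:ℚ] = 2`, Silverman VIII.5.4(b); the cross term vanishes by Galois orthogonality,
`heightPairing_eq_zero_of_conjMap`). [cite: SilvermanAEC2009, Prop. VIII.5.4(b) and Thm. VIII.9.3]
[cite: BombieriGubler2001, Prop. 1.5.17] -/
theorem sq_mul_regulator_baseChange_eq_rankOneOne (h2 : Module.finrank ℚ K = 2)
    {P₀ : V.toAffine.Point} (hP₀ : IsMordellWeilBasis (fun _ : Fin 1 => P₀))
    {P₁ : W.toAffine.Point} (hP₁ : IsMordellWeilBasis (fun _ : Fin 1 => P₁))
    {B : Fin 2 → (V.baseChange K).toAffine.Point} (hB : IsMordellWeilBasis B)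
    (σ : K →ₐ[ℚ] K) (Φ : W.toAffine.Point →+ (V.baseChange K).toAffine.Point)
    (hΦ : ∀ P : W.toAffine.Point, heightPairing (Φ P) (Φ P) = 2 * heightPairing P P)
    (hΦσ : ∀ P : W.toAffine.Point, QuadraticDescent.conjMap V σ (Φ P) = -Φ P)
    {a b c d : ℤ} {t t' : (V.baseChange K).toAffine.Point} (ht : IsOfFinAddOrder t)
    (ht' : IsOfFinAddOrder t') (hx : V.pointToBaseChange K P₀ = a • B 0 + b • B 1 + t)
    (hy : Φ P₁ = c • B 0 + d • B 1 + t') :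
    ((a * d - b * c : ℤ) : ℝ) ^ 2 * (V.baseChange K).regulator = 4 * V.regulator * W.regulator := by
  haveI : (V.baseChange K).IsElliptic := by rw [WeierstrassCurve.baseChange]; infer_instance
  obtain ⟨β, hβ⟩ := exists_heightPairingHom (V.baseChange K)
  have htors : ∀ P Q, IsOfFinAddOrder P → β P Q = 0 := fun P Q hP ↦ by
    rw [hβ]; exact heightPairing_eq_zero_of_isOfFinAddOrder_left hP Q
  have hsymm : ∀ P Q, β P Q = β Q P := fun P Q ↦ by rw [hβ, hβ, heightPairing_symm]
  have hgram := gram_det_comb_comb β htors hsymm (B 0) (B 1) a b c d ht ht'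
  rw [← hx, ← hy, hβ, hβ, hβ, hβ, hβ, hβ] at hgram
  -- the three entries of the Gram matrix of `(ιP₀, ΦP₁)`
  have hRegV : V.regulator = heightPairing P₀ P₀ := regulator_eq_heightPairing_of_isMordellWeilBasis_one hP₀
  have hRegW : W.regulator = heightPairing P₁ P₁ := regulator_eq_heightPairing_of_isMordellWeilBasis_one hP₁
  have hxx : heightPairing (V.pointToBaseChange K P₀) (V.pointToBaseChange K P₀) = 2 * V.regulator := by
    have h0 := heightPairing_baseChange (R := ℚ) (K := ℚ) (L := K) (W := V) P₀ P₀
    rw [pointToBaseChange_eq_baseChange, hRegV]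
    rw [h2] at h0
    exact_mod_cast h0
  have hyy : heightPairing (Φ P₁) (Φ P₁) = 2 * W.regulator := by rw [hRegW]; exact hΦ P₁
  have hxy : heightPairing (V.pointToBaseChange K P₀) (Φ P₁) = 0 :=
    heightPairing_eq_zero_of_conjMap K V σ (conjMap_pointToBaseChange K V σ P₀) (hΦσ P₁)
  rw [hxx, hyy, hxy, ← regulator_eq_det_of_isMordellWeilBasis_two hB] at hgram
  linear_combination -hgram

/-- **The index determinant is non-zero**: in the situation of
`sq_mul_regulator_baseChange_eq_rankOneOne`, `ad − bc ≠ 0` (both regulators over `ℚ` are positive,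
Silverman *AEC* VIII.9.6 / tree `regulator_pos_holds`). [cite: SilvermanAEC2009, Prop. VIII.9.6] -/
theorem indexDet_ne_zero_rankOneOne (h2 : Module.finrank ℚ K = 2)
    {P₀ : V.toAffine.Point} (hP₀ : IsMordellWeilBasis (fun _ : Fin 1 => P₀))
    {P₁ : W.toAffine.Point} (hP₁ : IsMordellWeilBasis (fun _ : Fin 1 => P₁))
    {B : Fin 2 → (V.baseChange K).toAffine.Point} (hB : IsMordellWeilBasis B)
    (σ : K →ₐ[ℚ] K) (Φ : W.toAffine.Point →+ (V.baseChange K).toAffine.Point)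
    (hΦ : ∀ P : W.toAffine.Point, heightPairing (Φ P) (Φ P) = 2 * heightPairing P P)
    (hΦσ : ∀ P : W.toAffine.Point, QuadraticDescent.conjMap V σ (Φ P) = -Φ P)
    {a b c d : ℤ} {t t' : (V.baseChange K).toAffine.Point} (ht : IsOfFinAddOrder t)
    (ht' : IsOfFinAddOrder t') (hx : V.pointToBaseChange K P₀ = a • B 0 + b • B 1 + t)
    (hy : Φ P₁ = c • B 0 + d • B 1 + t') :
    a * d - b * c ≠ 0 := by
  intro hM
  have h := sq_mul_regulator_baseChange_eq_rankOneOne K V W h2 hP₀ hP₁ hB σ Φ hΦ hΦσ ht ht' hx hy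
  rw [hM] at h
  have hpos : 0 < 4 * V.regulator * W.regulator :=
    mul_pos (mul_pos (by norm_num) (regulator_pos_holds V)) (regulator_pos_holds W)
  rw [← h] at hpos
  simp at hpos

/-! ## §2 The `p`-adic regulator factorisation in rank `(1,1)` -/

omit [NumberField K] [V.IsElliptic] [W.IsElliptic] in
/-- **`M²·Reg_p(V_K; B) = 4·Reg_p(V,D₀)·Reg_p(W,Dh)` in rank `(1,1)`** for a `K`-height datum `DK` on
`V(K)` which RESTRICTS along `ι : V(ℚ) → V(K)` to `[K:ℚ]·D₀ = 2·D₀` (`DK.RestrictsTo D₀`,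
Mazur–Tate–Teitelbaum §II.5), along the twisting transport `Φ` to `2·Dh` (Delbourgo 2002 p. 39:
`⟨,⟩_{p,ℚ}` of the additive twist `:= [K:ℚ]⁻¹⟨,⟩^{Sch}_{p,K}`), and is `σ`-INVARIANT (hypothesis `hinv`;
Galois orthogonality `padicHeightK_eq_zero_of_conjMap`): with `ιP₀ = aB₀ + bB₁ + t`,
`ΦP₁ = cB₀ + dB₁ + t'`, `{P₀}`, `{P₁}` Mordell–Weil bases of `V(ℚ)`, `W(ℚ)`:
`(ad − bc)²·(DK(B₀,B₀)DK(B₁,B₁) − DK(B₀,B₁)²) = 4·Reg_p(V,D₀)·Reg_p(W,Dh)`.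
[cite: MazurTateTeitelbaum1986Invent, §II.4–5] [cite: Delbourgo2002, p. 39] -/
theorem sq_mul_padicGram_baseChange_eq_rankOneOne [NumberField K] [V.IsElliptic] [W.IsElliptic]
    {p : ℕ} [Fact p.Prime] (h2 : Module.finrank ℚ K = 2)
    {P₀ : V.toAffine.Point} (hP₀ : IsMordellWeilBasis (fun _ : Fin 1 => P₀))
    {P₁ : W.toAffine.Point} (hP₁ : IsMordellWeilBasis (fun _ : Fin 1 => P₁))
    (B : Fin 2 → (V.baseChange K).toAffine.Point)
    (σ : K →ₐ[ℚ] K) (Φ : W.toAffine.Point →+ (V.baseChange K).toAffine.Point)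
    (hΦσ : ∀ P : W.toAffine.Point, QuadraticDescent.conjMap V σ (Φ P) = -Φ P)
    (DK : PAdicHeightDataK V p K) (D₀ : PAdicHeightData V p) (Dh : PAdicHeightData W p)
    (hres₀ : DK.RestrictsTo D₀)
    (hres₁ : ∀ P P' : W.toAffine.Point, DK.pairing (Φ P) (Φ P') = 2 * Dh.pairing P P')
    (hinv : ∀ x y, DK.pairing (QuadraticDescent.conjMap V σ x) (QuadraticDescent.conjMap V σ y) =
      DK.pairing x y)
    {a b c d : ℤ} {t t' : (V.baseChange K).toAffine.Point} (ht : IsOfFinAddOrder t)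
    (ht' : IsOfFinAddOrder t') (hx : V.pointToBaseChange K P₀ = a • B 0 + b • B 1 + t)
    (hy : Φ P₁ = c • B 0 + d • B 1 + t') :
    ((a * d - b * c : ℤ) : ℚ_[p]) ^ 2 *
        (DK.pairing (B 0) (B 0) * DK.pairing (B 1) (B 1) - DK.pairing (B 0) (B 1) ^ 2) =
      4 * padicRegulator D₀ * padicRegulator Dh := by
  have hgram := gram_det_comb_comb DK.pairing DK.map_torsion DK.symm (B 0) (B 1) a b c d ht ht'
  rw [← hx, ← hy] at hgram
  -- the rank-one `p`-adic regulators over `ℚ`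
  have hcardV : Fintype.card (Fin 1) = 1 := Fintype.card_fin 1
  have hRegV : padicRegulator D₀ = D₀.pairing P₀ P₀ := by
    rw [← padicRegulatorOf_eq_padicRegulator_holds D₀ hP₀, padicRegulatorOf]
    convert Matrix.det_eq_elem_of_card_eq_one (A := D₀.pairingMatrix fun _ : Fin 1 => P₀) hcardV 0
    rfl
  have hRegW : padicRegulator Dh = Dh.pairing P₁ P₁ := by
    rw [← padicRegulatorOf_eq_padicRegulator_holds Dh hP₁, padicRegulatorOf]
    convert Matrix.det_eq_elem_of_card_eq_one (A := Dh.pairingMatrix fun _ : Fin 1 => P₁) hcardV 0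
    rfl
  have hxx : DK.pairing (V.pointToBaseChange K P₀) (V.pointToBaseChange K P₀) = 2 * padicRegulator D₀ := by
    have h := hres₀ P₀ P₀
    rw [h2] at h
    rw [hRegV, h]
    norm_num
  have hyy : DK.pairing (Φ P₁) (Φ P₁) = 2 * padicRegulator Dh := by rw [hRegW]; exact hres₁ P₁ P₁
  have hxy : DK.pairing (V.pointToBaseChange K P₀) (Φ P₁) = 0 :=
    padicHeightK_eq_zero_of_conjMap K V DK σ hinv (conjMap_pointToBaseChange K V σ P₀) (hΦσ P₁)
  rw [hxx, hyy, hxy] at hgram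
  linear_combination -hgram

end Regulators

/-! ## §3 Milne's identity in rank `(1,1)`, regulators eliminated -/

section OverQuadratic

variable (K : Type) [Field K] [NumberField K]
  (V : WeierstrassCurve ℚ) [V.IsElliptic] [V.IsGloballyMinimal]
  (W : WeierstrassCurve ℚ) [W.IsElliptic] [W.IsGloballyMinimal]

omit [V.IsGloballyMinimal] [W.IsGloballyMinimal] in
/-- **Milne's identity in rank `(1,1)` as an identity of rationals.** `K` imaginary quadratic,
`W = C • V^{(d_K)}` of rank ONE (basis `{P₁}`), `V` of rank ONE (basis `{P₀}`), `B` a Mordell–Weil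
basis of `V(K)` (rank `2`), `σ`/`Φ` as in `sq_mul_regulator_baseChange_eq_rankOneOne` with
`ιP₀ = aB₀ + bB₁ + t`, `ΦP₁ = cB₀ + dB₁ + t'`, `M = ad − bc`; Milne's Weil-restriction identity for the
model `V ⊗ K` (`hWR`, the conclusion of `Milne1972.bsdQuotient_baseChange_quadratic_anyModel`). Then
`4·C(V⊗K)·#Ш(V_K)·#V(ℚ)_tors²·#W(ℚ)_tors² = M²·n_V·|u_C|·#Ш(V)·#Ш(W)·∏c(V)·∏c(W)·#V(K)_tors²`: the
periods cancel by `Ω(V)·Ω(V^{(d_K)}) = n_V·Ω(V_K/K)` and `Ω(W) = |u_C|·Ω(V^{(d_K)})`, the regulators by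
`M²·Reg(V_K) = 4·Reg(V)·Reg(W)`. [cite: Milne1972ArithmeticAV, §1 Thm. 1 and §2 (through DokchitserDokchitserAnnals2010, §2.1)]
[cite: SilvermanAEC2009, Prop. VIII.5.4(b)] -/
theorem card_identity_baseChange_rankOneOne [IsTotallyComplex K] (h2 : Module.finrank ℚ K = 2)
    {C : VariableChange ℚ} (hC : C • V.quadraticTwist (NumberField.discr K : ℚ) = W)
    {P₀ : V.toAffine.Point} (hP₀ : IsMordellWeilBasis (fun _ : Fin 1 => P₀))
    {P₁ : W.toAffine.Point} (hP₁ : IsMordellWeilBasis (fun _ : Fin 1 => P₁))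
    {B : Fin 2 → (V.baseChange K).toAffine.Point} (hB : IsMordellWeilBasis B)
    (σ : K →ₐ[ℚ] K) (Φ : W.toAffine.Point →+ (V.baseChange K).toAffine.Point)
    (hΦ : ∀ P : W.toAffine.Point, heightPairing (Φ P) (Φ P) = 2 * heightPairing P P)
    (hΦσ : ∀ P : W.toAffine.Point, QuadraticDescent.conjMap V σ (Φ P) = -Φ P)
    {a b c d : ℤ} {t t' : (V.baseChange K).toAffine.Point} (ht : IsOfFinAddOrder t)
    (ht' : IsOfFinAddOrder t') (hx : V.pointToBaseChange K P₀ = a • B 0 + b • B 1 + t)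
    (hy : Φ P₁ = c • B 0 + d • B 1 + t')
    (hWR : ((V.baseChange K).shaOrder : ℝ) * (V.baseChange K).regulator * (V.baseChange K).bsdPeriod *
        ((V.baseChange K).modifiedTamagawaProduct : ℝ) / ((V.baseChange K).torsionOrder : ℝ) ^ 2 =
      V.bsdRHS * W.bsdRHS) :
    (4 * (V.baseChange K).modifiedTamagawaProduct * (V.baseChange K).shaOrder *
        (V.torsionOrder : ℚ) ^ 2 * (W.torsionOrder : ℚ) ^ 2 : ℚ) =
      ((a * d - b * c : ℤ) : ℚ) ^ 2 * (V.baseChange ℝ).numRealComponents * |(C.u : ℚ)| * V.shaOrder *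
        W.shaOrder * V.tamagawaProduct * W.tamagawaProduct * ((V.baseChange K).torsionOrder : ℚ) ^ 2 := by
  haveI : (V.baseChange K).IsElliptic := by rw [WeierstrassCurve.baseChange]; infer_instance
  have hP : 0 < (V.baseChange K).bsdPeriod := bsdPeriod_pos' _
  have hΩW : W.realPeriodRat =
      |((C.u : ℚ) : ℝ)| * (V.quadraticTwist (NumberField.discr K : ℚ)).realPeriodRat := by
    rw [← hC]
    exact (V.quadraticTwist (NumberField.discr K : ℚ)).realPeriodRat_smul_holds C
  have hA : V.realPeriodRat * (V.quadraticTwist (NumberField.discr K : ℚ)).realPeriodRat =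
      ((V.baseChange ℝ).numRealComponents : ℝ) * (V.baseChange K).bsdPeriod :=
    realPeriod_mul_realPeriod_quadraticTwist_eq_mul_bsdPeriod V K h2
  -- the regulators
  have hreg : (((a * d - b * c : ℤ) : ℝ)) ^ 2 * (V.baseChange K).regulator = 4 * V.regulator * W.regulator :=
    sq_mul_regulator_baseChange_eq_rankOneOne K V W h2 hP₀ hP₁ hB σ Φ hΦ hΦσ ht ht' hx hy
  have hRVpos : 0 < V.regulator := regulator_pos_holds V
  have hRWpos : 0 < W.regulator := regulator_pos_holds W
  rw [bsdRHS_def, bsdRHS_def, hΩW] at hWR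
  have hNK : ((V.baseChange K).torsionOrder : ℝ) ≠ 0 := by
    exact_mod_cast ((V.baseChange K).torsionOrder_pos (V.baseChange K).finite_torsion_holds).ne'
  have hNV : (V.torsionOrder : ℝ) ≠ 0 := by exact_mod_cast (V.torsionOrder_pos V.finite_torsion_holds).ne'
  have hNW : (W.torsionOrder : ℝ) ≠ 0 := by exact_mod_cast (W.torsionOrder_pos W.finite_torsion_holds).ne'
  -- clear denominators in `ℝ`
  have hWR' : ((V.baseChange K).shaOrder : ℝ) * (V.baseChange K).regulator * (V.baseChange K).bsdPeriod *
        ((V.baseChange K).modifiedTamagawaProduct : ℝ) *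
        ((V.torsionOrder : ℝ) ^ 2 * (W.torsionOrder : ℝ) ^ 2) =
      (V.shaOrder : ℝ) * V.regulator * V.realPeriodRat * (V.tamagawaProduct : ℝ) *
        ((W.shaOrder : ℝ) * W.regulator * (|((C.u : ℚ) : ℝ)| *
          (V.quadraticTwist (NumberField.discr K : ℚ)).realPeriodRat) * (W.tamagawaProduct : ℝ)) *
        ((V.baseChange K).torsionOrder : ℝ) ^ 2 := by
    have h := hWR
    field_simp at h
    linear_combination h
  -- multiply by `M²`, substitute `M² Reg_K = 4 Reg(V) Reg(W)` and `Ω(V)Ω(V^{(d)}) = n P`,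
  -- cancel `Reg(V) · Reg(W) · P`
  set M : ℝ := ((a * d - b * c : ℤ) : ℝ) with hMdef
  have key : ((4 : ℝ) * ((V.baseChange K).modifiedTamagawaProduct : ℝ) * ((V.baseChange K).shaOrder : ℝ) *
        (V.torsionOrder : ℝ) ^ 2 * (W.torsionOrder : ℝ) ^ 2) *
        (V.regulator * W.regulator * (V.baseChange K).bsdPeriod) =
      ((M ^ 2 * ((V.baseChange ℝ).numRealComponents : ℝ) * |((C.u : ℚ) : ℝ)| * (V.shaOrder : ℝ) *
        (W.shaOrder : ℝ) * (V.tamagawaProduct : ℝ) * (W.tamagawaProduct : ℝ) *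
        ((V.baseChange K).torsionOrder : ℝ) ^ 2)) * (V.regulator * W.regulator * (V.baseChange K).bsdPeriod) := by
    linear_combination (M ^ 2) * hWR'
      - (((V.baseChange K).modifiedTamagawaProduct : ℝ) * ((V.baseChange K).shaOrder : ℝ) *
          (V.torsionOrder : ℝ) ^ 2 * (W.torsionOrder : ℝ) ^ 2 * (V.baseChange K).bsdPeriod) * hreg
      + (M ^ 2 * |((C.u : ℚ) : ℝ)| * (V.shaOrder : ℝ) * (W.shaOrder : ℝ) * V.regulator * W.regulator *
          (V.tamagawaProduct : ℝ) * (W.tamagawaProduct : ℝ) * ((V.baseChange K).torsionOrder : ℝ) ^ 2) * hA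
  have key' := mul_right_cancel₀ (mul_ne_zero (mul_ne_zero hRVpos.ne' hRWpos.ne') hP.ne') key
  rw [hMdef] at key'
  exact_mod_cast key'

omit [V.IsGloballyMinimal] [W.IsGloballyMinimal] in
/-- **Milne's rank-`(1,1)` identity in `p`-adic valuations** (odd `p`; the term `ord_p M²` is kept —
downstream it cancels against the same term of the `p`-adic leading-term identity over `K`):
`ord_p C(V⊗K) + ord_p #Ш(V_K) + 2 ord_p #V(ℚ)_tors + 2 ord_p #W(ℚ)_tors =
 2 ord_p M + ord_p |u_C| + ord_p #Ш(V) + ord_p #Ш(W) + ord_p ∏c(V) + ord_p ∏c(W) + 2 ord_p #V(K)_tors`,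
together with `C(V⊗K) ≠ 0` and `M ≠ 0`. [cite: Milne1972ArithmeticAV, §1 Thm. 1] -/
theorem padicVal_card_identity_rankOneOne [IsTotallyComplex K] (h2 : Module.finrank ℚ K = 2)
    (p : ℕ) [Fact p.Prime] (hp : p ≠ 2)
    {C : VariableChange ℚ} (hC : C • V.quadraticTwist (NumberField.discr K : ℚ) = W)
    (hfinV : V.ShaFinite) (hfinW : W.ShaFinite) (hshaK : (V.baseChange K).ShaFinite)
    {P₀ : V.toAffine.Point} (hP₀ : IsMordellWeilBasis (fun _ : Fin 1 => P₀))
    {P₁ : W.toAffine.Point} (hP₁ : IsMordellWeilBasis (fun _ : Fin 1 => P₁))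
    {B : Fin 2 → (V.baseChange K).toAffine.Point} (hB : IsMordellWeilBasis B)
    (σ : K →ₐ[ℚ] K) (Φ : W.toAffine.Point →+ (V.baseChange K).toAffine.Point)
    (hΦ : ∀ P : W.toAffine.Point, heightPairing (Φ P) (Φ P) = 2 * heightPairing P P)
    (hΦσ : ∀ P : W.toAffine.Point, QuadraticDescent.conjMap V σ (Φ P) = -Φ P)
    {a b c d : ℤ} {t t' : (V.baseChange K).toAffine.Point} (ht : IsOfFinAddOrder t)
    (ht' : IsOfFinAddOrder t') (hx : V.pointToBaseChange K P₀ = a • B 0 + b • B 1 + t)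
    (hy : Φ P₁ = c • B 0 + d • B 1 + t')
    (hWR : ((V.baseChange K).shaOrder : ℝ) * (V.baseChange K).regulator * (V.baseChange K).bsdPeriod *
        ((V.baseChange K).modifiedTamagawaProduct : ℝ) / ((V.baseChange K).torsionOrder : ℝ) ^ 2 =
      V.bsdRHS * W.bsdRHS) :
    (V.baseChange K).modifiedTamagawaProduct ≠ 0 ∧ a * d - b * c ≠ 0 ∧
    padicValRat p (V.baseChange K).modifiedTamagawaProduct + padicValNat p (V.baseChange K).shaOrder +
        2 * padicValNat p V.torsionOrder + 2 * padicValNat p W.torsionOrder =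
      2 * padicValRat p ((a * d - b * c : ℤ) : ℚ) + padicValRat p |(C.u : ℚ)| + padicValNat p V.shaOrder +
        padicValNat p W.shaOrder + padicValNat p V.tamagawaProduct + padicValNat p W.tamagawaProduct +
        2 * padicValNat p (V.baseChange K).torsionOrder := by
  haveI : (V.baseChange K).IsElliptic := by rw [WeierstrassCurve.baseChange]; infer_instance
  have hcard := card_identity_baseChange_rankOneOne K V W h2 hC hP₀ hP₁ hB σ Φ hΦ hΦσ ht ht' hx hy hWR
  have hM0 : a * d - b * c ≠ 0 := indexDet_ne_zero_rankOneOne K V W h2 hP₀ hP₁ hB σ Φ hΦ hΦσ ht ht' hx hy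
  have hnV0 : ((V.baseChange ℝ).numRealComponents : ℚ) ≠ 0 := by
    rw [numRealComponents]; split_ifs <;> norm_num
  have hSV0 : (V.shaOrder : ℚ) ≠ 0 := by exact_mod_cast (V.shaOrder_pos hfinV).ne'
  have hSW0 : (W.shaOrder : ℚ) ≠ 0 := by exact_mod_cast (W.shaOrder_pos hfinW).ne'
  have hSK0 : ((V.baseChange K).shaOrder : ℚ) ≠ 0 := by
    exact_mod_cast ((V.baseChange K).shaOrder_pos hshaK).ne'
  have hcV0 : (V.tamagawaProduct : ℚ) ≠ 0 := by exact_mod_cast V.tamagawaProduct_pos_holds.ne'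
  have hcW0 : (W.tamagawaProduct : ℚ) ≠ 0 := by exact_mod_cast W.tamagawaProduct_pos_holds.ne'
  have hNV0 : (V.torsionOrder : ℚ) ≠ 0 := by
    exact_mod_cast (V.torsionOrder_pos V.finite_torsion_holds).ne'
  have hNW0 : (W.torsionOrder : ℚ) ≠ 0 := by
    exact_mod_cast (W.torsionOrder_pos W.finite_torsion_holds).ne'
  have hNK0 : ((V.baseChange K).torsionOrder : ℚ) ≠ 0 := by
    exact_mod_cast ((V.baseChange K).torsionOrder_pos (V.baseChange K).finite_torsion_holds).ne'
  have hua0 : |(C.u : ℚ)| ≠ 0 := abs_ne_zero.mpr C.u.ne_zero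
  have hMq0 : ((a * d - b * c : ℤ) : ℚ) ≠ 0 := by exact_mod_cast hM0
  have h40 : (4 : ℚ) ≠ 0 := by norm_num
  have hM0' : (V.baseChange K).modifiedTamagawaProduct ≠ 0 := by
    intro hM
    have hRHS : V.bsdRHS * W.bsdRHS = 0 := by
      rw [← hWR, hM]; simp
    exact mul_ne_zero (V.bsdRHS_ne_zero hfinV) (W.bsdRHS_ne_zero hfinW) hRHS
  refine ⟨hM0', hM0, ?_⟩
  have hv4 : padicValRat p (4 : ℚ) = 0 := by
    have h22 : ¬ p ∣ 4 := by
      intro hd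
      have h4 : (4 : ℕ) = 2 ^ 2 := by norm_num
      rw [h4] at hd
      have := (Nat.Prime.dvd_of_dvd_pow (Fact.out : p.Prime) hd)
      have hle : p ≤ 2 := Nat.le_of_dvd two_pos this
      exact hp (le_antisymm hle (Fact.out : p.Prime).two_le)
    rw [show (4 : ℚ) = ((4 : ℕ) : ℚ) by norm_num, padicValRat.of_nat]
    exact_mod_cast padicValNat.eq_zero_of_not_dvd h22
  have hvcard := congrArg (padicValRat p) hcard
  rw [padicValRat.mul (mul_ne_zero (mul_ne_zero (mul_ne_zero h40 hM0') hSK0) (pow_ne_zero 2 hNV0))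
      (pow_ne_zero 2 hNW0),
    padicValRat.mul (mul_ne_zero (mul_ne_zero h40 hM0') hSK0) (pow_ne_zero 2 hNV0),
    padicValRat.mul (mul_ne_zero h40 hM0') hSK0, padicValRat.mul h40 hM0',
    padicValRat.pow, padicValRat.pow,
    padicValRat.mul (mul_ne_zero (mul_ne_zero (mul_ne_zero (mul_ne_zero (mul_ne_zero (mul_ne_zero
      (pow_ne_zero 2 hMq0) hnV0) hua0) hSV0) hSW0) hcV0) hcW0) (pow_ne_zero 2 hNK0),
    padicValRat.mul (mul_ne_zero (mul_ne_zero (mul_ne_zero (mul_ne_zero (mul_ne_zero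
      (pow_ne_zero 2 hMq0) hnV0) hua0) hSV0) hSW0) hcV0) hcW0,
    padicValRat.mul (mul_ne_zero (mul_ne_zero (mul_ne_zero (mul_ne_zero
      (pow_ne_zero 2 hMq0) hnV0) hua0) hSV0) hSW0) hcV0,
    padicValRat.mul (mul_ne_zero (mul_ne_zero (mul_ne_zero (pow_ne_zero 2 hMq0) hnV0) hua0) hSV0) hSW0,
    padicValRat.mul (mul_ne_zero (mul_ne_zero (pow_ne_zero 2 hMq0) hnV0) hua0) hSV0,
    padicValRat.mul (mul_ne_zero (pow_ne_zero 2 hMq0) hnV0) hua0,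
    padicValRat.mul (pow_ne_zero 2 hMq0) hnV0, padicValRat.pow, padicValRat.pow, hv4,
    padicValRat_numRealComponents_eq_zero V p hp,
    padicValRat.of_nat, padicValRat.of_nat, padicValRat.of_nat, padicValRat.of_nat,
    padicValRat.of_nat, padicValRat.of_nat, padicValRat.of_nat, padicValRat.of_nat] at hvcard
  push_cast at hvcard ⊢
  linarith

end OverQuadratic

end Summit.BirchSwinnertonDyer.Rank1Residual.Additive

end
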